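import Summits.QuantumFields.BalabanUV.T4Continuum.Support.TermwiseBackground

/-!
# TermwiseBackground (part 2/3) — the two plaquette estimates and the regularity predicate `LocReg`

HONEST FRAMING, PLACEMENT, ABSOLUTE RULE: see part 1/3 (`Support/TermwiseBackground`), whose module docstring
governs this file verbatim: FIXED FINITE four-torus, rung (B)+1, conditional; NOT infinite volume, NOT a mass
gap, NOT the Clay statement; the spine estimate NE7 is NOT PRINTED in [Balaban1984PropagatorsI]–
[Balaban1989LargeFieldII] and NOT proved here; no sentence of print is quoted; every hypothesis is a NAMED binder.

Contents: §4 THE TWO ESTIMATES for a configuration with a local gauge potential on an `l¹`-ball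
(`norm_hol_plaq_sub_one_le_of_potential`: `‖V(∂p) − 1‖ ≤ ‖curl B‖ + 16 b₀²`;
`norm_cov_osc_le_of_potential`: `‖V_b · log V(∂p_{x+e_κ}) · V_b⁻¹ − log V(∂p_x)‖ ≤ 4b₂ + 100 b₀b₁ + 132 b₀³`,
`b₀ ≤ 1/64`, by a SECOND-ORDER expansion of the plaquette product); §5 the regularity predicate
`LocReg V z R b₀ b₁ b₂` (a HYPOTHESIS SHAPE, never asserted) and the constants `cReg`, `cOscReg`.
-/

noncomputable section

open Finset MeasureTheory _root_.Filter _root_.Topology NormedSpace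
open scoped BigOperators Matrix.Norms.L2Operator InnerProductSpace

namespace Summit.QuantumFields.BalabanUV.T4Continuum.TermwiseBackground

open Literature.MathematicalPhysics.QuantumFieldTheory.Balaban1983to89
open T4OutputRate T4RecentScale T4GoodClassBudget T4CauchySum T4Crossover T4TowerRateComposition T4TowerRateDischarge
open T4BoundaryCarrier (BFunctional atFl NE9Fl LipBackgroundFl NE5B)
open T4TermwiseBudget T4TermwiseDeviation T4TermwiseCurrency T4TermwiseBoundary T4TermwiseResidual T4TermwiseAction
open T4TermwiseClassical T4TermwiseQuartic
open T4TermwiseInstantiate (cBCH cBCH_nonneg cSZ cSZ_nonneg)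
open T4TermwiseOscillation (cOSC)
open B7Prop1Explicit B7Prop2Explicit T4TermwiseBCH T4TermwiseTorus T4TermwiseUN T4TermwiseChainUN

/-! ## §4 The two estimates for a configuration with a local gauge potential on an `l¹`-ball -/

section Estimates

variable {d : ℕ} {𝔸 : Type*} [NormedRing 𝔸] [NormOneClass 𝔸] [NormedAlgebra ℂ 𝔸] [CompleteSpace 𝔸]

/-- Numerics: `4((1 + φ)⁴ − 1) ≤ 40 b₀` for `0 ≤ φ ≤ 2b₀`, `b₀ ≤ 1/64`. [folklore] -/
theorem numerics_prod {φ b₀ : ℝ} (hφ : 0 ≤ φ) (hφb : φ ≤ 2 * b₀) (hb : b₀ ≤ 1 / 64) :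
    4 * ((1 + φ) ^ 4 - 1) ≤ 40 * b₀ := by
  have hφs : φ ≤ 1 / 32 := by linarith
  have h2 : φ ^ 2 ≤ φ * (1 / 32) := by nlinarith
  have h3 : φ ^ 3 ≤ φ * (1 / 32) ^ 2 := by nlinarith
  have h4 : φ ^ 4 ≤ φ * (1 / 32) ^ 3 := by nlinarith
  nlinarith

/-- Numerics: `(φ(1 + φ) + φ)·2(2b₁ + 16b₀²) ≤ 20 b₀b₁ + 132 b₀³` for `0 ≤ φ ≤ 2b₀`, `0 ≤ b₀ ≤ 1/64`, `0 ≤ b₁`.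
[folklore] -/
theorem numerics_conj {φ b₀ b₁ : ℝ} (hφ : 0 ≤ φ) (hφb : φ ≤ 2 * b₀) (hb₀ : 0 ≤ b₀) (hb : b₀ ≤ 1 / 64)
    (hb₁ : 0 ≤ b₁) : (φ * (1 + φ) + φ) * (2 * (2 * b₁ + 16 * b₀ ^ 2)) ≤ 20 * b₀ * b₁ + 132 * b₀ ^ 3 := by
  have p1 : φ * b₁ ≤ 2 * b₀ * b₁ := mul_le_mul_of_nonneg_right hφb hb₁
  have p2 : φ ^ 2 ≤ 4 * b₀ ^ 2 := by nlinarith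
  have p3 : φ ^ 2 * b₁ ≤ 4 * b₀ ^ 2 * b₁ := mul_le_mul_of_nonneg_right p2 hb₁
  have p4 : b₀ ^ 2 * b₁ ≤ b₀ * b₁ * (1 / 64) := by nlinarith [mul_nonneg hb₀ hb₁]
  have p5 : φ * b₀ ^ 2 ≤ 2 * b₀ ^ 3 := by nlinarith [sq_nonneg b₀]
  have p6 : φ ^ 2 * b₀ ^ 2 ≤ 4 * b₀ ^ 4 := by nlinarith [sq_nonneg b₀]
  have p7 : b₀ ^ 4 ≤ b₀ ^ 3 * (1 / 64) := by nlinarith [pow_nonneg hb₀ 3]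
  nlinarith

/-- **(44)-type bound from a local gauge potential.** On the `l¹`-ball of radius `R` about `z` let
`V(x,κ) = u(x) e^{B(x,κ)} u(x+e_κ)⁻¹` with norm-bounded gauge units `u` (19) and `‖B‖ ≤ b₀ ≤ 1/64`; then for every
plaquette started within distance `R − 4` of `z`:
`‖V(∂p_y) − 1‖ ≤ ‖B(y,μ) + B(y+e_μ,ν) − B(y+e_ν,μ) − B(y,ν)‖ + 16 b₀²` (gauge covariance (8) of closed contours,
`‖uXu⁻¹ − 1‖ ≤ ‖X − 1‖`, and the expansion of one transporter to first order with the discrete curl as linear term).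
[folklore] -/
theorem norm_hol_plaq_sub_one_le_of_potential (z : B7Prop1Explicit.Site d) (R : ℕ)
    {u : B7Prop1Explicit.Site d → 𝔸ˣ} {B : B7Prop1Explicit.Site d → Fin d → 𝔸}
    {V : B7Prop1Explicit.Site d → Fin d → 𝔸ˣ} {b₀ : ℝ} (hu : ∀ x, u x ∈ U1 𝔸)
    (hrep : ∀ x κ, l1 (x - z) ≤ R → V x κ = gaugeAct u (fun y ι => expUnit (B y ι)) x κ)
    (hB₀ : ∀ x κ, l1 (x - z) ≤ R → ‖B x κ‖ ≤ b₀) (hb₀ : 0 ≤ b₀) (hb₀' : b₀ ≤ 1 / 64)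
    (y : B7Prop1Explicit.Site d) (hy : l1 (y - z) + 4 ≤ R) (μ ν : Fin d) :
    ‖((hol V y (plaqWord μ ν) : 𝔸ˣ) : 𝔸) - 1‖ ≤ ‖B y μ + B (y + e μ) ν - B (y + e ν) μ - B y ν‖ + 16 * b₀ ^ 2 := by
  have hy4 : l1 (y - z) + (plaqWord μ ν : List (Letter d)).length ≤ R := by simpa [plaqWord] using hy
  rw [hol_congr_of_ball z R hrep (plaqWord μ ν) y hy4, hol_gaugeAct_closed _ _ _ _ (disp_plaqWord μ ν),
    Units.val_mul, Units.val_mul]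
  refine (norm_units_conj_sub_one_le (hu y) _).trans ?_
  obtain ⟨-, h2⟩ := walk_linear (fun x κ => expUnit (B x κ)) B z R hb₀ (fun x κ hx => ⟨rfl, hB₀ x κ hx⟩)
    (plaqWord μ ν) y hy4
  rw [asum_plaqWord] at h2
  have hlen : (((plaqWord μ ν : List (Letter d)).length : ℕ) : ℝ) * b₀ = 4 * b₀ := by simp [plaqWord]
  rw [hlen] at h2
  calc ‖((hol (fun x κ => expUnit (B x κ)) y (plaqWord μ ν) : 𝔸ˣ) : 𝔸) - 1‖
      ≤ ‖B y μ + B (y + e μ) ν - B (y + e ν) μ - B y ν‖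
          + ‖((hol (fun x κ => expUnit (B x κ)) y (plaqWord μ ν) : 𝔸ˣ) : 𝔸) - 1
              - (B y μ + B (y + e μ) ν - B (y + e ν) μ - B y ν)‖ := norm_le_insert' _ _
    _ ≤ _ := by gcongr; exact h2.trans (expRem4_le hb₀ hb₀')
set_option maxHeartbeats 400000 in
/-- **(44∇)-type bound from a local gauge potential.** On the `l¹`-ball of radius `R ≥ 5` about `z` let
`V(x,κ) = u(x) e^{B(x,κ)} u(x+e_κ)⁻¹` with norm-bounded gauge units `u`, `‖B‖ ≤ b₀ ≤ 1/64`, first lattice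
differences of `B` at most `b₁` and second differences at most `b₂` (on the ball).  Then the covariant oscillation of
the plaquette logarithm (21) across the bond `⟨z, z+e_κ⟩` obeys
`‖V(z,κ)·log V(∂p_{z+e_κ})·V(z,κ)⁻¹ − log V(∂p_z)‖ ≤ 4b₂ + 100 b₀b₁ + 132 b₀³` — by the SECOND-ORDER comparison of
the two plaquette products (§2: the linear term is the `κ`-difference of the discrete curl, a sum of two second
differences; the error is `O(b₀b₁)`), the Lipschitz bound for the logarithm, its conjugation covariance, and
`‖e^{B}Xe^{−B} − X‖ = O(b₀)‖X‖` with `‖X‖ = O(b₁ + b₀²)`. [folklore] -/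
theorem norm_cov_osc_le_of_potential (z : B7Prop1Explicit.Site d) (R : ℕ) (hR : 5 ≤ R)
    {u : B7Prop1Explicit.Site d → 𝔸ˣ} {B : B7Prop1Explicit.Site d → Fin d → 𝔸}
    {V : B7Prop1Explicit.Site d → Fin d → 𝔸ˣ} {b₀ b₁ b₂ : ℝ} (hu : ∀ x, u x ∈ U1 𝔸)
    (hrep : ∀ x κ, l1 (x - z) ≤ R → V x κ = gaugeAct u (fun y ι => expUnit (B y ι)) x κ)
    (hB₀ : ∀ x κ, l1 (x - z) ≤ R → ‖B x κ‖ ≤ b₀)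
    (hB₁ : ∀ x κ ι, l1 (x - z) ≤ R → l1 (x + e ι - z) ≤ R → ‖B (x + e ι) κ - B x κ‖ ≤ b₁)
    (hB₂ : ∀ x κ ι ι', l1 (x - z) ≤ R → l1 (x + e ι + e ι' - z) ≤ R →
      ‖B (x + e ι + e ι') κ - B (x + e ι') κ - (B (x + e ι) κ - B x κ)‖ ≤ b₂)
    (hb₀ : 0 ≤ b₀) (hb₀' : b₀ ≤ 1 / 64) (hb₁ : 0 ≤ b₁) (κ μ ν : Fin d) :
    ‖((V z κ : 𝔸ˣ) : 𝔸) * MatrixLog.mlog ((hol V (z + e κ) (plaqWord μ ν) : 𝔸ˣ) : 𝔸) * (((V z κ)⁻¹ : 𝔸ˣ) : 𝔸)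
        - MatrixLog.mlog ((hol V z (plaqWord μ ν) : 𝔸ˣ) : 𝔸)‖ ≤ 4 * b₂ + 100 * b₀ * b₁ + 132 * b₀ ^ 3 := by
  -- distances
  have s0 : l1 (z - z) ≤ R := by simp [l1]
  have s1 : ∀ ι : Fin d, l1 (z + e ι - z) ≤ R := fun ι => by rw [add_sub_cancel_left, l1_e]; omega
  have s2 : ∀ ι ι' : Fin d, l1 (z + e ι + e ι' - z) ≤ R := fun ι ι' => by
    rw [add_assoc, add_sub_cancel_left]; have := l1_e_add_e (d := d) ι ι'; omega
  have t0 : l1 (z - z) + 4 ≤ R := by simp [l1]; omega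
  have t1 : l1 (z + e κ - z) + 4 ≤ R := by rw [add_sub_cancel_left, l1_e]; omega
  -- the potential configuration and its plaquette products
  set W : B7Prop1Explicit.Site d → 𝔸 := fun y =>
    exp (B y μ) * exp (B (y + e μ) ν) * exp (-(B (y + e ν) μ)) * exp (-(B y ν)) with hWdef
  have hWhol : ∀ y, l1 (y - z) + 4 ≤ R →
      ((hol V y (plaqWord μ ν) : 𝔸ˣ) : 𝔸) = (u y : 𝔸) * W y * ((u y)⁻¹ : 𝔸ˣ) := by
    intro y hy
    have hy4 : l1 (y - z) + (plaqWord μ ν : List (Letter d)).length ≤ R := by simpa [plaqWord] using hy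
    rw [hol_congr_of_ball z R hrep (plaqWord μ ν) y hy4, hol_gaugeAct_closed _ _ _ _ (disp_plaqWord μ ν),
      Units.val_mul, Units.val_mul, hol_plaqWord_expUnit]
  -- first order: `‖W y − 1‖ ≤ 8 b₀ ≤ 1/2` and `‖W y − 1 − curl‖ ≤ 16 b₀²`
  have hfirst : ∀ y, l1 (y - z) + 4 ≤ R →
      ‖W y - 1‖ ≤ 1 / 2 ∧ ‖W y - 1 - (B y μ + B (y + e μ) ν - B (y + e ν) μ - B y ν)‖ ≤ 16 * b₀ ^ 2 := by
    intro y hy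
    have hy4 : l1 (y - z) + (plaqWord μ ν : List (Letter d)).length ≤ R := by simpa [plaqWord] using hy
    obtain ⟨h1, h2⟩ := walk_linear (fun x κ => expUnit (B x κ)) B z R hb₀ (fun x κ hx => ⟨rfl, hB₀ x κ hx⟩)
      (plaqWord μ ν) y hy4
    rw [hol_plaqWord_expUnit] at h1 h2
    rw [asum_plaqWord] at h2
    have hlen : (((plaqWord μ ν : List (Letter d)).length : ℕ) : ℝ) * b₀ = 4 * b₀ := by simp [plaqWord]
    rw [hlen] at h1 h2
    exact ⟨h1.trans ((exp4_sub_one_le hb₀ hb₀').trans (by linarith)), h2.trans (expRem4_le hb₀ hb₀')⟩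
  -- abbreviations
  set z' := z + e κ with hz'
  obtain ⟨hW'1, hW'c⟩ := hfirst z' t1
  obtain ⟨hW1, -⟩ := hfirst z t0
  have hW'lt : ‖W z' - 1‖ < 1 := by linarith
  have hWlt : ‖W z - 1‖ < 1 := by linarith
  -- the bond variable and its inverse
  have hVz : ((V z κ : 𝔸ˣ) : 𝔸) = (u z : 𝔸) * exp (B z κ) * ((u z')⁻¹ : 𝔸ˣ) := by
    rw [hrep z κ s0]; rfl
  have hVzi : (((V z κ)⁻¹ : 𝔸ˣ) : 𝔸) = (u z' : 𝔸) * exp (-(B z κ)) * ((u z)⁻¹ : 𝔸ˣ) := by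
    rw [hrep z κ s0, hz']
    simp only [gaugeAct, mul_inv_rev, inv_inv, val_inv_expUnit, Units.val_mul, val_expUnit, mul_assoc]
  -- rewrite the oscillation as a conjugate of `e^{B} X e^{−B} − Y`
  set X := MatrixLog.mlog (W z') with hX
  set Y := MatrixLog.mlog (W z) with hY
  have hPP : (((u z')⁻¹ : 𝔸ˣ) : 𝔸) * (u z' : 𝔸) = 1 := Units.inv_mul _
  have key : ((V z κ : 𝔸ˣ) : 𝔸) * MatrixLog.mlog ((hol V z' (plaqWord μ ν) : 𝔸ˣ) : 𝔸) * (((V z κ)⁻¹ : 𝔸ˣ) : 𝔸)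
        - MatrixLog.mlog ((hol V z (plaqWord μ ν) : 𝔸ˣ) : 𝔸)
      = (u z : 𝔸) * (exp (B z κ) * X * exp (-(B z κ)) - Y) * ((u z)⁻¹ : 𝔸ˣ) := by
    rw [hWhol z' t1, hWhol z t0, mlog_units_conj (hu z') hW'lt, mlog_units_conj (hu z) hWlt, hVz, hVzi, ← hX, ← hY]
    calc (u z : 𝔸) * exp (B z κ) * ((u z')⁻¹ : 𝔸ˣ) * ((u z' : 𝔸) * X * ((u z')⁻¹ : 𝔸ˣ))
          * ((u z' : 𝔸) * exp (-(B z κ)) * ((u z)⁻¹ : 𝔸ˣ)) - (u z : 𝔸) * Y * ((u z)⁻¹ : 𝔸ˣ)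
        = (u z : 𝔸) * exp (B z κ) * ((((u z')⁻¹ : 𝔸ˣ) : 𝔸) * (u z' : 𝔸)) * X
            * ((((u z')⁻¹ : 𝔸ˣ) : 𝔸) * (u z' : 𝔸)) * exp (-(B z κ)) * ((u z)⁻¹ : 𝔸ˣ)
            - (u z : 𝔸) * Y * ((u z)⁻¹ : 𝔸ˣ) := by noncomm_ring
      _ = _ := by rw [hPP]; noncomm_ring
  rw [key]
  -- strip the outer conjugation
  have hstrip : ‖(u z : 𝔸) * (exp (B z κ) * X * exp (-(B z κ)) - Y) * ((u z)⁻¹ : 𝔸ˣ)‖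
      ≤ ‖exp (B z κ) * X * exp (-(B z κ)) - Y‖ := by
    calc _ ≤ ‖(u z : 𝔸)‖ * ‖exp (B z κ) * X * exp (-(B z κ)) - Y‖ * ‖(((u z)⁻¹ : 𝔸ˣ) : 𝔸)‖ := by
          refine (norm_mul_le _ _).trans ?_; gcongr; exact norm_mul_le _ _
      _ ≤ 1 * ‖exp (B z κ) * X * exp (-(B z κ)) - Y‖ * 1 := by
          gcongr; exacts [(hu z).1, (hu z).2]
      _ = _ := by ring
  refine hstrip.trans ?_
  -- split: `(e^B X e^{−B} − X) + (X − Y)`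
  have hsplit : ‖exp (B z κ) * X * exp (-(B z κ)) - Y‖
      ≤ ‖exp (B z κ) * X * exp (-(B z κ)) - X‖ + ‖X - Y‖ := by
    rw [show exp (B z κ) * X * exp (-(B z κ)) - Y = (exp (B z κ) * X * exp (-(B z κ)) - X) + (X - Y) by abel]
    exact norm_add_le _ _
  refine hsplit.trans ?_
  -- the exponential factors near `1`
  set φ := Real.exp b₀ - 1 with hφ
  have hφ0 : 0 ≤ φ := by rw [hφ]; linarith [Real.add_one_le_exp b₀]
  have hφb : φ ≤ 2 * b₀ := exp_sub_one_le_of_le le_rfl hb₀ hb₀'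
  have hexpφ : Real.exp b₀ = 1 + φ := by rw [hφ]; ring
  have hE : ∀ {C : 𝔸}, ‖C‖ ≤ b₀ → ‖exp C - 1‖ ≤ φ ∧ ‖exp C‖ ≤ 1 + φ := by
    intro C hC
    have h := (norm_exp_sub_one_le_of_norm_le hC).1
    exact ⟨h, norm_le_one_add_of_norm_sub_one_le h⟩
  have hBz : ‖B z κ‖ ≤ b₀ := hB₀ z κ s0
  have hBzn : ‖-(B z κ)‖ ≤ b₀ := by rw [norm_neg]; exact hBz
  -- (a) the conjugation term
  have hXle : ‖X‖ ≤ 2 * (2 * b₁ + 16 * b₀ ^ 2) := by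
    have h1 : ‖X‖ ≤ 2 * ‖W z' - 1‖ := MatrixLog.norm_mlog_le_two_mul hW'1
    have hcurl : ‖B z' μ + B (z' + e μ) ν - B (z' + e ν) μ - B z' ν‖ ≤ 2 * b₁ := by
      rw [show B z' μ + B (z' + e μ) ν - B (z' + e ν) μ - B z' ν
          = (B (z' + e μ) ν - B z' ν) - (B (z' + e ν) μ - B z' μ) by abel]
      refine (norm_sub_le _ _).trans ?_
      have hμ := hB₁ z' ν μ (s1 κ) (s2 κ μ)
      have hν := hB₁ z' μ ν (s1 κ) (s2 κ ν)
      linarith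
    have h2 : ‖W z' - 1‖ ≤ 2 * b₁ + 16 * b₀ ^ 2 := by
      have := norm_le_insert' (W z' - 1) (B z' μ + B (z' + e μ) ν - B (z' + e ν) μ - B z' ν)
      linarith
    linarith
  have hconj : ‖exp (B z κ) * X * exp (-(B z κ)) - X‖ ≤ 20 * b₀ * b₁ + 132 * b₀ ^ 3 := by
    refine (norm_conj_sub_self_le _ _ _).trans ?_
    have hc : ‖exp (B z κ) - 1‖ * ‖exp (-(B z κ))‖ + ‖exp (-(B z κ)) - 1‖ ≤ φ * (1 + φ) + φ := by
      have := mul_le_mul (hE hBz).1 (hE hBzn).2 (norm_nonneg _) hφ0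
      linarith [(hE hBzn).1]
    calc _ ≤ (φ * (1 + φ) + φ) * (2 * (2 * b₁ + 16 * b₀ ^ 2)) :=
          mul_le_mul hc hXle (norm_nonneg _) (add_nonneg (mul_nonneg hφ0 (by linarith)) hφ0)
      _ ≤ _ := numerics_conj hφ0 hφb hb₀ hb₀' hb₁
  -- (b) the difference of the two plaquette products: second order
  have hd : ∀ {C C' : 𝔸}, ‖C‖ ≤ b₀ → ‖C'‖ ≤ b₀ → ‖C - C'‖ ≤ b₁ →
      ‖exp C - exp C' - (C - C')‖ ≤ φ * b₁ ∧ ‖exp C - exp C'‖ ≤ (1 + φ) * b₁ := by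
    intro C C' hC hC' hCC'
    have h := norm_exp_sub_exp_sub_le hC hC'
    rw [← hφ] at h
    have h1 : ‖exp C - exp C' - (C - C')‖ ≤ φ * b₁ := h.trans (mul_le_mul_of_nonneg_left hCC' hφ0)
    have h2 := norm_le_insert' (exp C - exp C') (C - C')
    exact ⟨h1, by nlinarith⟩
  -- the four first differences in direction `κ`
  have e₁ : ‖B z' μ - B z μ‖ ≤ b₁ := hB₁ z μ κ s0 (s1 κ)
  have e₂ : ‖B (z' + e μ) ν - B (z + e μ) ν‖ ≤ b₁ := by
    have := hB₁ (z + e μ) ν κ (s1 μ) (s2 μ κ)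
    rwa [add_right_comm z (e μ) (e κ)] at this
  have e₃ : ‖-(B (z' + e ν) μ) - -(B (z + e ν) μ)‖ ≤ b₁ := by
    have := hB₁ (z + e ν) μ κ (s1 ν) (s2 ν κ)
    rwa [add_right_comm z (e ν) (e κ), ← norm_neg, show -(B (z + e κ + e ν) μ - B (z + e ν) μ)
      = -(B (z + e κ + e ν) μ) - -(B (z + e ν) μ) by abel] at this
  have e₄ : ‖-(B z' ν) - -(B z ν)‖ ≤ b₁ := by
    have := hB₁ z ν κ s0 (s1 κ)
    rwa [← norm_neg, show -(B (z + e κ) ν - B z ν) = -(B (z + e κ) ν) - -(B z ν) by abel] at this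
  -- norms of the eight potentials
  have n₁ : ‖B z' μ‖ ≤ b₀ := hB₀ _ _ (s1 κ)
  have n₁' : ‖B z μ‖ ≤ b₀ := hB₀ _ _ s0
  have n₂ : ‖B (z' + e μ) ν‖ ≤ b₀ := hB₀ _ _ (s2 κ μ)
  have n₂' : ‖B (z + e μ) ν‖ ≤ b₀ := hB₀ _ _ (s1 μ)
  have n₃ : ‖-(B (z' + e ν) μ)‖ ≤ b₀ := by rw [norm_neg]; exact hB₀ _ _ (s2 κ ν)
  have n₃' : ‖-(B (z + e ν) μ)‖ ≤ b₀ := by rw [norm_neg]; exact hB₀ _ _ (s1 ν)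
  have n₄ : ‖-(B z' ν)‖ ≤ b₀ := by rw [norm_neg]; exact hB₀ _ _ (s1 κ)
  have n₄' : ‖-(B z ν)‖ ≤ b₀ := by rw [norm_neg]; exact hB₀ _ _ s0
  obtain ⟨g₁, d₁⟩ := hd n₁ n₁' e₁
  obtain ⟨g₂, d₂⟩ := hd n₂ n₂' e₂
  obtain ⟨g₃, d₃⟩ := hd n₃ n₃' e₃
  obtain ⟨g₄, d₄⟩ := hd n₄ n₄' e₄
  have hprod := norm_prod4_sub_prod4_sub_le hφ0 (mul_nonneg (by linarith) hb₁ : 0 ≤ (1 + φ) * b₁)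
    (hE n₂).1 (hE n₃).1 (hE n₄).1 (hE n₁').1 (hE n₂').1 (hE n₃').1 d₁ d₂ d₃ d₄
  -- the linear term is the `κ`-difference of the curl: two second differences
  have hlin : ‖(B z' μ - B z μ) + (B (z' + e μ) ν - B (z + e μ) ν) + (-(B (z' + e ν) μ) - -(B (z + e ν) μ))
        + (-(B z' ν) - -(B z ν))‖ ≤ 2 * b₂ := by
    rw [show (B z' μ - B z μ) + (B (z' + e μ) ν - B (z + e μ) ν) + (-(B (z' + e ν) μ) - -(B (z + e ν) μ))
        + (-(B z' ν) - -(B z ν))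
        = (B (z + e κ + e μ) ν - B (z + e μ) ν - (B (z + e κ) ν - B z ν))
          - (B (z + e κ + e ν) μ - B (z + e ν) μ - (B (z + e κ) μ - B z μ)) by rw [hz']; abel]
    refine (norm_sub_le _ _).trans ?_
    have h1 := hB₂ z ν κ μ s0 (s2 κ μ)
    have h2 := hB₂ z μ κ ν s0 (s2 κ ν)
    linarith
  have hWW : ‖W z' - W z‖ ≤ 2 * b₂ + 40 * b₀ * b₁ := by
    have hsplit2 : W z' - W z
        = ((B z' μ - B z μ) + (B (z' + e μ) ν - B (z + e μ) ν) + (-(B (z' + e ν) μ) - -(B (z + e ν) μ))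
            + (-(B z' ν) - -(B z ν)))
          + ((W z' - W z - (exp (B z' μ) - exp (B z μ) + (exp (B (z' + e μ) ν) - exp (B (z + e μ) ν))
              + (exp (-(B (z' + e ν) μ)) - exp (-(B (z + e ν) μ))) + (exp (-(B z' ν)) - exp (-(B z ν)))))
            + ((exp (B z' μ) - exp (B z μ) - (B z' μ - B z μ))
              + (exp (B (z' + e μ) ν) - exp (B (z + e μ) ν) - (B (z' + e μ) ν - B (z + e μ) ν))
              + (exp (-(B (z' + e ν) μ)) - exp (-(B (z + e ν) μ)) - (-(B (z' + e ν) μ) - -(B (z + e ν) μ)))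
              + (exp (-(B z' ν)) - exp (-(B z ν)) - (-(B z' ν) - -(B z ν))))) := by abel
    rw [hsplit2]
    refine (norm_add_le _ _).trans ?_
    refine (add_le_add hlin ((norm_add_le _ _).trans (add_le_add hprod
      ((norm_add_le _ _).trans (add_le_add (norm_add₃_le) g₄))))).trans ?_
    have hnum := numerics_prod hφ0 hφb hb₀'
    nlinarith [g₁, g₂, g₃]
  have hXY : ‖X - Y‖ ≤ 4 * b₂ + 80 * b₀ * b₁ := by
    have h := norm_mlog_sub_mlog_le hW'1 hW1 (by norm_num : (1 : ℝ) / 2 < 1)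
    rw [← hX, ← hY] at h
    refine h.trans ?_
    norm_num
    linarith
  linarith

end Estimates

/-! ## §5 The local-regularity predicate and the constants -/

section Regularity

variable {d : ℕ} {𝔸 : Type*} [NormedRing 𝔸] [NormOneClass 𝔸] [NormedAlgebra ℂ 𝔸] [CompleteSpace 𝔸]

/-- **Local gauge potential with bounded size, first and second differences** (the cell's transcription SHAPE of a
background-regularity statement "`U^{u^{-1}} = e^{iηA}` on a cube, `|A|`, `|∇^η A|` and the `β₀ = 1` Hölder seminorm of
`∇^η A` bounded", read on the unit lattice).  `LocReg V z R b₀ b₁ b₂`: there are norm-bounded gauge units `u` (19)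
and an algebra-valued bond function `B` with `V(x,κ) = u(x)·e^{B(x,κ)}·u(x+e_κ)⁻¹` for `|x − z|₁ ≤ R`, and on that
ball `‖B‖ ≤ b₀`, `‖B(x+e_ι,κ) − B(x,κ)‖ ≤ b₁`, `‖∇_ι∇_{ι'}B(·,κ)(x)‖ ≤ b₂`.  A HYPOTHESIS on a configuration, never
asserted of any particular one. [folklore] -/
def LocReg (V : B7Prop1Explicit.Site d → Fin d → 𝔸ˣ) (z : B7Prop1Explicit.Site d) (R : ℕ) (b₀ b₁ b₂ : ℝ) : Prop :=
  ∃ (u : B7Prop1Explicit.Site d → 𝔸ˣ) (B : B7Prop1Explicit.Site d → Fin d → 𝔸),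
    (∀ x, u x ∈ U1 𝔸) ∧
    (∀ x κ, l1 (x - z) ≤ R → V x κ = gaugeAct u (fun y ι => expUnit (B y ι)) x κ) ∧
    (∀ x κ, l1 (x - z) ≤ R → ‖B x κ‖ ≤ b₀) ∧
    (∀ x κ ι, l1 (x - z) ≤ R → l1 (x + e ι - z) ≤ R → ‖B (x + e ι) κ - B x κ‖ ≤ b₁) ∧
    (∀ x κ ι ι', l1 (x - z) ≤ R → l1 (x + e ι + e ι' - z) ≤ R →
      ‖B (x + e ι + e ι') κ - B (x + e ι') κ - (B (x + e ι) κ - B x κ)‖ ≤ b₂)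

/-- `LocReg` is monotone in the three bounds. [folklore] -/
theorem LocReg.mono {V : B7Prop1Explicit.Site d → Fin d → 𝔸ˣ} {z : B7Prop1Explicit.Site d} {R : ℕ}
    {b₀ b₁ b₂ b₀' b₁' b₂' : ℝ} (h : LocReg V z R b₀ b₁ b₂) (h₀ : b₀ ≤ b₀') (h₁ : b₁ ≤ b₁') (h₂ : b₂ ≤ b₂') :
    LocReg V z R b₀' b₁' b₂' := by
  obtain ⟨u, B, hu, hrep, hB₀, hB₁, hB₂⟩ := h
  exact ⟨u, B, hu, hrep, fun x κ hx => (hB₀ x κ hx).trans h₀, fun x κ ι hx hx' => (hB₁ x κ ι hx hx').trans h₁,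
    fun x κ ι ι' hx hx' => (hB₂ x κ ι ι' hx hx').trans h₂⟩

/-- **(44)-type bound at the centre from `LocReg`** (radius `≥ 4`): `‖V(∂p_z) − 1‖ ≤ 2b₁ + 16b₀²`. [folklore] -/
theorem LocReg.norm_hol_plaq_sub_one_le {V : B7Prop1Explicit.Site d → Fin d → 𝔸ˣ} {z : B7Prop1Explicit.Site d}
    {R : ℕ} {b₀ b₁ b₂ : ℝ} (h : LocReg V z R b₀ b₁ b₂) (hR : 4 ≤ R) (hb₀ : 0 ≤ b₀) (hb₀' : b₀ ≤ 1 / 64)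
    (μ ν : Fin d) : ‖((hol V z (plaqWord μ ν) : 𝔸ˣ) : 𝔸) - 1‖ ≤ 2 * b₁ + 16 * b₀ ^ 2 := by
  obtain ⟨u, B, hu, hrep, hB₀, hB₁, -⟩ := h
  have s0 : l1 (z - z) ≤ R := by simp [l1]
  have s1 : ∀ ι : Fin d, l1 (z + e ι - z) ≤ R := fun ι => by rw [add_sub_cancel_left, l1_e]; omega
  have h1 := norm_hol_plaq_sub_one_le_of_potential z R hu hrep hB₀ hb₀ hb₀' z (by simp [l1]; omega) μ ν
  have hcurl : ‖B z μ + B (z + e μ) ν - B (z + e ν) μ - B z ν‖ ≤ 2 * b₁ := by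
    rw [show B z μ + B (z + e μ) ν - B (z + e ν) μ - B z ν
        = (B (z + e μ) ν - B z ν) - (B (z + e ν) μ - B z μ) by abel]
    refine (norm_sub_le _ _).trans ?_
    have hμ := hB₁ z ν μ s0 (s1 μ)
    have hν := hB₁ z μ ν s0 (s1 ν)
    linarith
  linarith

/-- **(44∇)-type bound at the centre from `LocReg`** (radius `≥ 5`):
`‖V(z,κ)·log V(∂p_{z+e_κ})·V(z,κ)⁻¹ − log V(∂p_z)‖ ≤ 4b₂ + 100 b₀b₁ + 132 b₀³`. [folklore] -/
theorem LocReg.norm_cov_osc_le {V : B7Prop1Explicit.Site d → Fin d → 𝔸ˣ} {z : B7Prop1Explicit.Site d} {R : ℕ}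
    {b₀ b₁ b₂ : ℝ} (h : LocReg V z R b₀ b₁ b₂) (hR : 5 ≤ R) (hb₀ : 0 ≤ b₀) (hb₀' : b₀ ≤ 1 / 64) (hb₁ : 0 ≤ b₁)
    (κ μ ν : Fin d) :
    ‖((V z κ : 𝔸ˣ) : 𝔸) * MatrixLog.mlog ((hol V (z + e κ) (plaqWord μ ν) : 𝔸ˣ) : 𝔸) * (((V z κ)⁻¹ : 𝔸ˣ) : 𝔸)
        - MatrixLog.mlog ((hol V z (plaqWord μ ν) : 𝔸ˣ) : 𝔸)‖ ≤ 4 * b₂ + 100 * b₀ * b₁ + 132 * b₀ ^ 3 := by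
  obtain ⟨u, B, hu, hrep, hB₀, hB₁, hB₂⟩ := h
  exact norm_cov_osc_le_of_potential z R hR hu hrep hB₀ hB₁ hB₂ hb₀ hb₀' hb₁ κ μ ν

/-- The constant configuration `V ≡ 1` is `LocReg` about every site with every radius and bounds `(0,0,0)`
(`u ≡ 1`, `B ≡ 0`): non-vacuity of the predicate. [folklore] -/
theorem locReg_one (z : B7Prop1Explicit.Site d) (R : ℕ) :
    LocReg (fun (_ : B7Prop1Explicit.Site d) (_ : Fin d) => (1 : 𝔸ˣ)) z R 0 0 0 :=
  have h0 : expUnit (0 : 𝔸) = 1 := Units.ext (by simp)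
  ⟨fun _ => 1, fun _ _ => 0, fun _ => Subgroup.one_mem _, fun x κ _ => by simp [gaugeAct, h0], by simp, by simp,
    by simp⟩

/-- The (44) constant produced from the regularity radii `(a₀, a₁, ·)`: `cReg a₀ a₁ = 2a₁ + 16a₀²`
(so `α₀(K) = cReg·ε₁·L^{−2K}`). [folklore] -/
def cReg (a₀ a₁ : ℝ) : ℝ := 2 * a₁ + 16 * a₀ ^ 2

/-- The (44∇) constant produced from the regularity radii: `cOscReg L a₀ a₁ a₂ = (4a₂ + 100a₀a₁ + 132a₀³)·L²`
(so `α₁(K) = (4a₂ + 100a₀a₁ + 132a₀³)·ε₁·L^{−3K} = cOscReg·ε₁·L^{−2(K+1)}·L^{−K}`). [folklore] -/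
def cOscReg (L : ℕ) (a₀ a₁ a₂ : ℝ) : ℝ := (4 * a₂ + 100 * a₀ * a₁ + 132 * a₀ ^ 3) * (L : ℝ) ^ 2

/-- Unfolding lemma for `cReg`. [folklore] -/
theorem cReg_def (a₀ a₁ : ℝ) : cReg a₀ a₁ = 2 * a₁ + 16 * a₀ ^ 2 := rfl

/-- Unfolding lemma for `cOscReg`. [folklore] -/
theorem cOscReg_def (L : ℕ) (a₀ a₁ a₂ : ℝ) :
    cOscReg L a₀ a₁ a₂ = (4 * a₂ + 100 * a₀ * a₁ + 132 * a₀ ^ 3) * (L : ℝ) ^ 2 := rfl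

/-- `0 ≤ cReg a₀ a₁` for `0 ≤ a₁`. [folklore] -/
theorem cReg_nonneg (a₀ : ℝ) {a₁ : ℝ} (ha₁ : 0 ≤ a₁) : 0 ≤ cReg a₀ a₁ := by unfold cReg; positivity

/-- `0 ≤ cOscReg L a₀ a₁ a₂` for nonnegative radii. [folklore] -/
theorem cOscReg_nonneg (L : ℕ) {a₀ a₁ a₂ : ℝ} (ha₀ : 0 ≤ a₀) (ha₁ : 0 ≤ a₁) (ha₂ : 0 ≤ a₂) :
    0 ≤ cOscReg L a₀ a₁ a₂ := by unfold cOscReg; positivity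

/-- The smallness `20480·L²·cReg·ε₁ ≤ 1` (with `L ≥ 2`, `ε₁ ≤ 1`) forces `a₀ε₁ ≤ 1/64` — the potential is in
the range of the logarithm/exponential estimates. [folklore] -/
theorem a₀ε₁_le_of_smallness {L : ℕ} (hL : 2 ≤ L) {a₀ a₁ ε₁ : ℝ} (ha₀ : 0 ≤ a₀) (ha₁ : 0 ≤ a₁) (hε₁ : 0 ≤ ε₁)
    (hε₁1 : ε₁ ≤ 1) (hsmall : 20480 * (L : ℝ) ^ 2 * (cReg a₀ a₁ * ε₁) ≤ 1) : a₀ * ε₁ ≤ 1 / 64 := by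
  have hL2 : (2 : ℝ) ≤ L := by exact_mod_cast hL
  have hL4 : (4 : ℝ) ≤ (L : ℝ) ^ 2 := by nlinarith
  unfold cReg at hsmall
  have h1 : a₀ ^ 2 * ε₁ ≤ 1 / 1310720 := by
    nlinarith [mul_nonneg (mul_nonneg ha₁ hε₁) (sq_nonneg (L : ℝ)),
      mul_nonneg (mul_nonneg (sq_nonneg a₀) hε₁) (by linarith : (0 : ℝ) ≤ (L : ℝ) ^ 2 - 4)]
  have h2 : (a₀ * ε₁) ^ 2 ≤ a₀ ^ 2 * ε₁ := by nlinarith [mul_nonneg (mul_nonneg (sq_nonneg a₀) hε₁) (sub_nonneg.2 hε₁1)]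
  nlinarith [mul_nonneg ha₀ hε₁]

end Regularity

end Summit.QuantumFields.BalabanUV.T4Continuum.TermwiseBackground
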